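import Mathlib
import Literature.Barriers.MatrixMultiplication.NormalizerBarrier
import Literature.RepresentationTheory.FiniteGroups.CharacterDegrees
import Literature.RepresentationTheory.FiniteGroups.IrreducibleCharacters
import Literature.RepresentationTheory.FiniteGroups.InducedClassFunction
import Literature.RepresentationTheory.FiniteGroups.BrauerInduction
import Summits.MatrixMultiplication.MatrixMultiplication.Theorems.LieRankDesigns.Negative.Basics
import Summits.MatrixMultiplication.MatrixMultiplication.Theorems.SubgroupIdentityDesigns.Negative.BlockSliceConditional
import Summits.MatrixMultiplication.MatrixMultiplication.Theorems.SubgroupIdentityDesigns.Negative.BlockSliceTranslate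
import Summits.MatrixMultiplication.MatrixMultiplication.Theorems.SubgroupIdentityDesigns.Negative.ConstituentLevel
import Summits.MatrixMultiplication.MatrixMultiplication.Theorems.SubgroupIdentityDesigns.Negative.GrassmannNoGo
import Summits.MatrixMultiplication.MatrixMultiplication.Theorems.SubgroupIdentityDesigns.Negative.FlagCharacter
import Summits.MatrixMultiplication.MatrixMultiplication.Theorems.SubgroupIdentityDesigns.Negative.FlagOrbits
import Summits.MatrixMultiplication.MatrixMultiplication.Theorems.SubgroupIdentityDesigns.Negative.FlagDegree

/-!
# General-`k` block-slice no-go with a LOGARITHMIC window: `l ≥ 3 + 6⌈log₂(k+1)⌉`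

Supports stmt-MatrixMultiplication-14079 (crux `SubgroupIdentityDesigns`, route
    `LevelGradedCohnUmans`;
BLOCK-SLICES §2).  VALUE = theorem, NOT summit progress.

`BlockSliceGeneral.no_translate_witness` closes the block-slice line for `l ≥ 3k + 6` using the
Grassmannian permutation character (`⟨Φ, Φ⟩ ≤ k + 1`, degree `≥ p^{kl}`).  Here the same argument
is run with the permutation character `Ψ = Ind_{P'}^G 1` of the smaller parabolic `P'` = stabiliser
of the partial flag `⟨e₁⟩ ⊂ ⟨e₁,e₂⟩ ⊂ ⋯ ⊂ ⟨e₁,…,e_k⟩` (`FlagCharacter`): `Ψ ∈ F_k`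
(`flagChar_mem_levelSet`), `⟨Ψ, Ψ⟩ ≤ (k+1)^k` (`FlagOrbits.classInner_flagChar_le`) and
`Ψ(1) ≥ p^{kl} p^{k(k-1)/2}` (`FlagDegree.flagChar_one_ge`).  The extra factor `p^{k(k-1)/2}` in the
degree cancels the `p^{3k²}` of the volume bound, so the window becomes logarithmic in `k`:
* `not_budget_lt_of_char` / `_translate` — the no-go for an ABSTRACT character `Φ ∈ F_k` with
  `⟨Φ, Φ⟩ ≤ c`, `Φ(1) ≥ D ≥ 0` and `c⁶ p^{3k²+5kl} ≤ D⁶` (some irreducible `ψ ∈ Irr ∩ F_k` has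
  `c ψ(1) ≥ D`, `ConstituentLevel.exists_irrChar_levelSet_degree_ge`; volume
  `V² < p^{3k²+5kl}`, `GrassmannNoGo.volume_sq_lt_real`; hence `V^{s/3} < ψ(1)^s ≤ budget`);
* `threshold` — `((k+1)^k)⁶ p^{3k²+5kl} ≤ (p^{kl} p^{∑_{i<k} i})⁶` once `l ≥ 3 + 6⌈log₂(k+1)⌉`;
* **`no_translate_witness`**, `no_slice_witness`, `no_slice_witness'` — for every `k ≥ 1`, every
  `l ≥ 3 + 6 ⌈log₂(k+1)⌉` (`Nat.clog 2 (k+1)`), every prime `p`, every `ε > 0` and every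
      subgroup-TPP
  triple of `GL_{k+l}(𝔽_p)` whose products lie in a two-sided translate `x S_{k+l,k} y` of the block
  slice, the crux inequality `∑ᶠ_{ψ ∈ Irr ∩ F_k} ψ(1)^{2+ε} < (|H₁||H₂||H₃|)^{(2+ε)/3}` FAILS.
  E.g. `k ≤ 3 ⇒ l ≥ 15`, `k ≤ 7 ⇒ l ≥ 21`, versus `l ≥ 3k + 6` before.
-/

set_option linter.dupNamespace false

noncomputable section

open scoped BigOperators Matrix Classical
open Literature.Barriers.MatrixMultiplication (SubgroupTPP)
open Literature.RepresentationTheory.FiniteGroups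
open Summit.MatrixMultiplication.MatrixMultiplication.Theorems.LieRankDesigns.Negative

namespace Summit.MatrixMultiplication.MatrixMultiplication.Theorems.SubgroupIdentityDesigns.Negative
namespace FlagNoGo

open BlockSliceConditional (rpow_le_budget)
open BlockSliceTranslate (translate_to_conj_fin)
open ConstituentLevel (exists_irrChar_levelSet_degree_ge)
open GrassmannNoGo (volume_sq_lt_real)
open FlagCharacter (flagChar isCharacter_flagChar flagChar_mem_levelSet flagChar_one_ne_zero)
open FlagOrbits (classInner_flagChar_le)
open FlagDegree (flagChar_one_ge two_mul_sum_range)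

variable {p : ℕ} [hp : Fact p.Prime] {k l : ℕ}

/-! ## The no-go for an abstract level-`k` character -/

/-- **No-go from a character `Φ ∈ F_k` with `⟨Φ, Φ⟩ ≤ c`, `Φ(1) ≥ D`, `c⁶ p^{3k²+5kl} ≤ D⁶`**
(`k ≥ 1`): for every subgroup-TPP triple of `GL_{k+l}(𝔽_p)` with products in a conjugate block slice
and every `s > 0`, `¬ (budget_k(s) < V^{s/3})`. -/
theorem not_budget_lt_of_char (hk : 1 ≤ k) {Φ : GLm p (k + l) → ℂ}
    (hΦ : IsCharacter (GLm p (k + l)) Φ) (hΦk : Φ ∈ levelSet p (k + l) k) (hΦ0 : Φ 1 ≠ 0)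
    {c D : ℝ} (hc0 : 0 < c) (hc : (classInner Φ Φ).re ≤ c) (hD0 : 0 ≤ D) (hD : D ≤ (Φ 1).re)
    (hthr : c ^ 6 * (p : ℝ) ^ (3 * (k * k) + 5 * k * l) ≤ D ^ 6)
    {H₁ H₂ H₃ : Subgroup (GLm p (k + l))} (htpp : SubgroupTPP H₁ H₂ H₃) (x : GLm p (k + l))
    (hS : ∀ a ∈ H₁, ∀ b ∈ H₂, ∀ c ∈ H₃, ∀ i j : Fin l,
      ((x⁻¹ * (a * b * c) * x : GLm p (k + l)) : Mat p (k + l)) (Fin.natAdd k i) (Fin.natAdd k j) =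
        (1 : Matrix (Fin l) (Fin l) (ZMod p)) i j)
    {s : ℝ} (hs : 0 < s) :
    ¬ (budget p (k + l) k s < ((Nat.card H₁ * Nat.card H₂ * Nat.card H₃ : ℕ) : ℝ) ^ (s / 3)) := by
  intro hlt
  obtain ⟨ψ, hψ, hdeg⟩ := exists_irrChar_levelSet_degree_ge hΦ hΦk hΦ0
  have hdeg' : D ≤ c * (ψ 1).re :=
    (hD.trans hdeg).trans (mul_le_mul_of_nonneg_right hc (re_apply_one_nonneg hψ.1))
  have hV := volume_sq_lt_real hk htpp x hS
  set V : ℝ := ((Nat.card H₁ * Nat.card H₂ * Nat.card H₃ : ℕ) : ℝ) with hVdef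
  have hV0 : 0 ≤ V := Nat.cast_nonneg _
  set u : ℝ := V ^ ((1 : ℝ) / 3) with hu
  have hu0 : 0 ≤ u := Real.rpow_nonneg hV0 _
  have hu6 : u ^ 6 = V ^ 2 := by
    rw [hu, ← Real.rpow_natCast, ← Real.rpow_mul hV0, ← Real.rpow_two]
    congr 1
    norm_num
  -- `(c u)⁶ = c⁶ V² < c⁶ p^{3k²+5kl} ≤ D⁶`
  have h6 : (c * u) ^ 6 < D ^ 6 := by
    rw [mul_pow, hu6]
    calc c ^ 6 * V ^ 2 < c ^ 6 * (p : ℝ) ^ (3 * (k * k) + 5 * k * l) :=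
          mul_lt_mul_of_pos_left hV (pow_pos hc0 6)
      _ ≤ D ^ 6 := hthr
  have hcu : c * u < D :=
    not_le.mp fun hge => absurd h6 (not_lt.mpr (pow_le_pow_left₀ hD0 hge 6))
  have hu_lt : u < (ψ 1).re := lt_of_mul_lt_mul_left (hcu.trans_le hdeg') hc0.le
  have h1 : V ^ (s / 3) = u ^ s := by
    rw [hu, ← Real.rpow_mul hV0]
    congr 1
    ring
  have h2 : u ^ s < (ψ 1).re ^ s := Real.rpow_lt_rpow hu0 hu_lt hs
  have h3 : (ψ 1).re ^ s ≤ budget p (k + l) k s := rpow_le_budget hψ s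
  rw [h1] at hlt
  linarith

/-- **The same on every two-sided translate `x S y`, at the crux's exponents.** -/
theorem not_budget_lt_of_char_translate (hk : 1 ≤ k) {Φ : GLm p (k + l) → ℂ}
    (hΦ : IsCharacter (GLm p (k + l)) Φ) (hΦk : Φ ∈ levelSet p (k + l) k) (hΦ0 : Φ 1 ≠ 0)
    {c D : ℝ} (hc0 : 0 < c) (hc : (classInner Φ Φ).re ≤ c) (hD0 : 0 ≤ D) (hD : D ≤ (Φ 1).re)
    (hthr : c ^ 6 * (p : ℝ) ^ (3 * (k * k) + 5 * k * l) ≤ D ^ 6)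
    {H₁ H₂ H₃ : Subgroup (GLm p (k + l))} (htpp : SubgroupTPP H₁ H₂ H₃) (x y : GLm p (k + l))
    (hS : ∀ a ∈ H₁, ∀ b ∈ H₂, ∀ c ∈ H₃, ∀ i j : Fin l,
      ((x⁻¹ * (a * b * c) * y⁻¹ : GLm p (k + l)) : Mat p (k + l)) (Fin.natAdd k i)
          (Fin.natAdd k j) = (1 : Matrix (Fin l) (Fin l) (ZMod p)) i j)
    {ε : ℝ} (hε : 0 < ε) :
    ¬ ((∑ᶠ ψ ∈ irrChars (GLm p (k + l)) ∩ levelSet p (k + l) k, (ψ 1).re ^ (2 + ε)) <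
        ((Nat.card H₁ * Nat.card H₂ * Nat.card H₃ : ℕ) : ℝ) ^ ((2 + ε) / 3)) := by
  have h1 := hS 1 H₁.one_mem 1 H₂.one_mem 1 H₃.one_mem
  simp only [mul_one] at h1
  obtain ⟨z, hz⟩ := translate_to_conj_fin x y h1
  exact not_budget_lt_of_char hk hΦ hΦk hΦ0 hc0 hc hD0 hD hthr htpp z
    (fun a ha b hb c hc => hz _ (hS a ha b hb c hc)) (s := 2 + ε) (by linarith)

/-! ## The numeric side condition for the flag character -/

/-- For `k ≥ 1`, `l ≥ 3 + 6⌈log₂(k+1)⌉` and any prime `p`: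
`((k+1)^k)⁶ p^{3k²+5kl} ≤ (p^{kl} p^{∑_{i<k} i})⁶` (`k + 1 ≤ 2^{⌈log₂(k+1)⌉} ≤ p^{⌈log₂(k+1)⌉}` and
`6 ∑_{i<k} i = 3k² - 3k`). -/
theorem threshold (hk : 1 ≤ k) (hl : 3 + 6 * Nat.clog 2 (k + 1) ≤ l) :
    ((((k + 1) ^ k : ℕ) : ℝ)) ^ 6 * (p : ℝ) ^ (3 * (k * k) + 5 * k * l) ≤
      (((p ^ (k * l) * p ^ (∑ i ∈ Finset.range k, i) : ℕ) : ℝ)) ^ 6 := by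
  have hp2 : 2 ≤ p := hp.out.two_le
  have h2e : 2 * (∑ i ∈ Finset.range k, i) = k * (k - 1) := two_mul_sum_range k
  obtain ⟨k, rfl⟩ : ∃ k', k = k' + 1 := ⟨k - 1, by omega⟩
  set c₂ := Nat.clog 2 (k + 1 + 1) with hc₂
  set e := ∑ i ∈ Finset.range (k + 1), i with he
  have h1 : k + 1 + 1 ≤ p ^ c₂ :=
    (Nat.le_pow_clog (by norm_num) _).trans (Nat.pow_le_pow_left hp2 _)
  have h2 : (k + 1 + 1) ^ (k + 1) ≤ p ^ (c₂ * (k + 1)) := by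
    rw [pow_mul]
    exact Nat.pow_le_pow_left h1 _
  have h2e' : 2 * e = (k + 1) * k := by rw [h2e, Nat.add_sub_cancel]
  have h6e : 6 * e + 3 * (k + 1) = 3 * ((k + 1) * (k + 1)) := by nlinarith [h2e']
  have hkl : (k + 1) * (3 + 6 * c₂) ≤ (k + 1) * l := Nat.mul_le_mul_left _ hl
  have hexp : 6 * (c₂ * (k + 1)) + (3 * ((k + 1) * (k + 1)) + 5 * (k + 1) * l) ≤
      ((k + 1) * l + e) * 6 := by nlinarith [h6e, hkl]
  have h3 : ((k + 1 + 1) ^ (k + 1)) ^ 6 * p ^ (3 * ((k + 1) * (k + 1)) + 5 * (k + 1) * l) ≤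
      (p ^ ((k + 1) * l) * p ^ e) ^ 6 := by
    calc ((k + 1 + 1) ^ (k + 1)) ^ 6 * p ^ (3 * ((k + 1) * (k + 1)) + 5 * (k + 1) * l)
        ≤ (p ^ (c₂ * (k + 1))) ^ 6 * p ^ (3 * ((k + 1) * (k + 1)) + 5 * (k + 1) * l) :=
          Nat.mul_le_mul_right _ (Nat.pow_le_pow_left h2 6)
      _ = p ^ (6 * (c₂ * (k + 1)) + (3 * ((k + 1) * (k + 1)) + 5 * (k + 1) * l)) := by
          rw [← pow_mul, ← pow_add, mul_comm (c₂ * (k + 1)) 6]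
      _ ≤ p ^ (((k + 1) * l + e) * 6) := Nat.pow_le_pow_right (by omega) hexp
      _ = (p ^ ((k + 1) * l) * p ^ e) ^ 6 := by rw [← pow_add, ← pow_mul]
  exact_mod_cast h3

/-! ## The unconditional no-go with a logarithmic window -/

/-- **General-`k` block-slice no-go, logarithmic window.**  For `k ≥ 1`, `l ≥ 3 + 6⌈log₂(k+1)⌉`,
any prime `p` and any `ε > 0`, no subgroup-TPP triple with products in a translate `x S_{k+l,k} y`
of the block slice satisfies the budget inequality of the crux `SubgroupIdentityDesigns`. -/
theorem no_translate_witness (hk : 1 ≤ k) (hl : 3 + 6 * Nat.clog 2 (k + 1) ≤ l)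
    {H₁ H₂ H₃ : Subgroup (GLm p (k + l))} (htpp : SubgroupTPP H₁ H₂ H₃) (x y : GLm p (k + l))
    (hS : ∀ a ∈ H₁, ∀ b ∈ H₂, ∀ c ∈ H₃, ∀ i j : Fin l,
      ((x⁻¹ * (a * b * c) * y⁻¹ : GLm p (k + l)) : Mat p (k + l)) (Fin.natAdd k i)
          (Fin.natAdd k j) = (1 : Matrix (Fin l) (Fin l) (ZMod p)) i j)
    {ε : ℝ} (hε : 0 < ε) :
    ¬ ((∑ᶠ ψ ∈ irrChars (GLm p (k + l)) ∩ levelSet p (k + l) k, (ψ 1).re ^ (2 + ε)) <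
        ((Nat.card H₁ * Nat.card H₂ * Nat.card H₃ : ℕ) : ℝ) ^ ((2 + ε) / 3)) :=
  not_budget_lt_of_char_translate hk (isCharacter_flagChar (F := ZMod p) (k := k) (l := l))
    flagChar_mem_levelSet flagChar_one_ne_zero (c := (((k + 1) ^ k : ℕ) : ℝ))
    (D := (((p ^ (k * l) * p ^ (∑ i ∈ Finset.range k, i) : ℕ) : ℝ))) (by positivity)
    classInner_flagChar_le (Nat.cast_nonneg _) flagChar_one_ge (threshold hk hl) htpp x y hS hε

/-- The block slice itself (`x = y = 1`): products `abc` with lower-right `l × l` block `= 1`. -/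
theorem no_slice_witness (hk : 1 ≤ k) (hl : 3 + 6 * Nat.clog 2 (k + 1) ≤ l)
    {H₁ H₂ H₃ : Subgroup (GLm p (k + l))} (htpp : SubgroupTPP H₁ H₂ H₃)
    (hS : ∀ a ∈ H₁, ∀ b ∈ H₂, ∀ c ∈ H₃, ∀ i j : Fin l,
      ((a * b * c : GLm p (k + l)) : Mat p (k + l)) (Fin.natAdd k i) (Fin.natAdd k j) =
        (1 : Matrix (Fin l) (Fin l) (ZMod p)) i j)
    {ε : ℝ} (hε : 0 < ε) :
    ¬ ((∑ᶠ ψ ∈ irrChars (GLm p (k + l)) ∩ levelSet p (k + l) k, (ψ 1).re ^ (2 + ε)) <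
        ((Nat.card H₁ * Nat.card H₂ * Nat.card H₃ : ℕ) : ℝ) ^ ((2 + ε) / 3)) :=
  no_translate_witness hk hl htpp 1 1
    (fun a ha b hb c hc i j => by simpa using hS a ha b hb c hc i j) hε

/-- The same in terms of `m = k + l`: for `m ≥ k + 3 + 6⌈log₂(k+1)⌉` no subgroup-TPP triple of
`GL_m(𝔽_p)` with products in the slice `S_{m,k}` beats the level-`k` budget with exponent `2 + ε`.
    -/
theorem no_slice_witness' (hk : 1 ≤ k) {m : ℕ} (hm : k + 3 + 6 * Nat.clog 2 (k + 1) ≤ m) :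
    ∃ l, m = k + l ∧ ∀ {H₁ H₂ H₃ : Subgroup (GLm p (k + l))}, SubgroupTPP H₁ H₂ H₃ →
      (∀ a ∈ H₁, ∀ b ∈ H₂, ∀ c ∈ H₃, ∀ i j : Fin l,
        ((a * b * c : GLm p (k + l)) : Mat p (k + l)) (Fin.natAdd k i) (Fin.natAdd k j) =
          (1 : Matrix (Fin l) (Fin l) (ZMod p)) i j) →
      ∀ {ε : ℝ}, 0 < ε →
        ¬ ((∑ᶠ ψ ∈ irrChars (GLm p (k + l)) ∩ levelSet p (k + l) k, (ψ 1).re ^ (2 + ε)) <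
            ((Nat.card H₁ * Nat.card H₂ * Nat.card H₃ : ℕ) : ℝ) ^ ((2 + ε) / 3)) :=
  ⟨m - k, by omega, fun htpp hS _ hε => no_slice_witness hk (by omega) htpp hS hε⟩

/-- Sample windows: `⌈log₂ 4⌉ = 2` and `⌈log₂ 8⌉ = 3`, so `k ≤ 3 ⇒ l ≥ 15` and `k ≤ 7 ⇒ l ≥ 21`
suffice. -/
theorem clog_samples : Nat.clog 2 4 = 2 ∧ Nat.clog 2 8 = 3 := by
  constructor <;> decide

end FlagNoGo
end Summit.MatrixMultiplication.MatrixMultiplication.Theorems.SubgroupIdentityDesigns.Negative
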